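import Literature.Probability.RandomPlanarGeometry.PlanarBrownianEscape
import Literature.Probability.RandomPlanarGeometry.PlanarSausageBound
import Literature.Probability.RandomPlanarGeometry.BrownianBridgeTransfer
import Literature.Probability.RandomPlanarGeometry.BrownianBridgeReversal
import Literature.Probability.RandomPlanarGeometry.PlanarEndpointSmall
import HarnessLib

/-!
# Brownian loop masses: the chain of estimates for large loops (free parameters)

Proof file (theorems only). Let `b_s = Z_s − s • Z_1` (`s ≤ 1`) be the planar Brownian bridge of the
loop-measure file (`BrownianLoopMeasure`: the unrooted Brownian loop of duration `t` rooted at `z` is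
`z + √t b`). The expected AREA of the set of roots `w` for which the unit bridge `w + b` visits the
closed disc `B̄(0, R')` and avoids the open disc `B(c, r')`,

  `G = E |{w : (∃ s ≤ 1, w + b_s ∈ B̄(0, R')) ∧ ∀ s ≤ 1, w + b_s ∉ B(c, r')}|`,

is what the large-`t` part of the loop mass `Λ(K₁, K₂; D)` reduces to after scaling
(`R' = R/√t`, `c = z₀/√t`, `r' = r/√t`). This file chains the tree's estimates into ONE bound on `G`
with free parameters (`lintegral_volume_bridge_hit_avoid_le`):

1. `G ≤ 2 G_{1/2}` — hits during `[1/2, 1]` are as likely as hits during `[0, 1/2]`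
   (`lintegral_volume_bridge_hit_late_eq_early`, time reversal);
2. Tonelli: `G_{1/2} = ∫ P(·) dA(w)`;
3. for each `w`, bridge → Brownian motion with a small endpoint
   (`measure_bridge_event_le_mul_inter_small`, factor `7/η²`, `η = r'/8`), the Brownian event being
   "`w + Z` visits `B̄(c, a)` by time `1/2` and avoids `B̄(c, r'/2)` up to time `3/4`",
   `a = R' + |c| + r'`;
4. the small endpoint costs `(2η/√(2π/4))²` (`measure_inter_endpoints_small_le`, `T = 3/4`);
5. the avoidance after the hit costs `log(2a/r')/log(2ρ/r') + 2ρ²`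
   (`measure_hit_then_avoid_le`, `θ = 1/4`);
6. the remaining `∫ P(w + Z visits B̄(c, a) by time 1/2) dA(w)` is bounded by
   `lintegral_measure_hit_closedBall_le`.

The choice of the parameters as functions of the scale is made in `BrownianLoopMassCore`.
No definition and no named fact is introduced.

## References

* G. F. Lawler, *Partition functions, loop measure, and versions of SLE*, J. Stat. Phys. 134 (2009),
  §2.2 (finiteness of `Λ(K₁, K₂; D)` for `∂D` nonpolar — stated). [Lawler2009]
* G. F. Lawler, W. Werner, *The Brownian loop soup*, PTRF 128 (2004), §4. [LawlerWerner2004]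
-/

noncomputable section

open MeasureTheory ProbabilityTheory Filter Set Metric Complex
open scoped NNReal ENNReal Topology

namespace Literature.Probability.RandomPlanarGeometry

open Literature.Probability.Process
open BrownianLoop (planarBrownian)

/-! ### Small lemmas -/

/-- `|Z_1| ≤ 2η` when both endpoint coordinates are at most `η` in absolute value. [folklore] -/
theorem norm_planarBrownian_one_le {η : ℝ} {ω : WienerPair} (h : |brownian 1 ω.1| ≤ η ∧ |brownian 1 ω.2| ≤ η) :
    ‖planarBrownian 1 ω‖ ≤ 2 * η := by
  have := norm_planarBrownian_le 1 ω
  linarith [h.1, h.2]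

/-- On the small-endpoint event the Brownian path is uniformly `2η`-close to the bridge on `[0, 1]`:
`|(w + Z_s) − (w + b_s)| = s |Z_1| ≤ 2η`. [folklore] -/
theorem norm_sub_bridge_le {η : ℝ} {ω : WienerPair}
    (h : |brownian 1 ω.1| ≤ η ∧ |brownian 1 ω.2| ≤ η) {s : ℝ≥0} (hs : s ≤ 1) (w : ℂ) :
    ‖(w + planarBrownian s ω) - (w + (planarBrownian s ω - (s : ℝ) • planarBrownian 1 ω))‖ ≤ 2 * η := by
  have h1 : (w + planarBrownian s ω) - (w + (planarBrownian s ω - (s : ℝ) • planarBrownian 1 ω)) =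
      (s : ℝ) • planarBrownian 1 ω := by abel
  rw [h1, norm_smul, Real.norm_eq_abs, abs_of_nonneg s.coe_nonneg]
  have hs' : (s : ℝ) ≤ 1 := by exact_mod_cast hs
  calc (s : ℝ) * ‖planarBrownian 1 ω‖ ≤ 1 * (2 * η) :=
        mul_le_mul hs' (norm_planarBrownian_one_le h) (norm_nonneg _) zero_le_one
    _ = 2 * η := one_mul _

/-- **Bridge events are jointly measurable in (sample, root).** For `A` closed, `O` open and `i`,
there is a measurable `M ⊆ WienerPair × ℂ` whose sections are the bridge event
"`w + b` visits `A` by time `i` and avoids `O` up to time `1`". [folklore] -/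
theorem exists_measurableSet_bridge_event {A : Set ℂ} (hA : IsClosed A) {O : Set ℂ} (hO : IsOpen O) (i : ℝ≥0) :
    ∃ M : Set (WienerPair × ℂ), MeasurableSet M ∧
      (∀ ω : WienerPair, {w : ℂ | (∃ s : ℝ≥0, s ≤ i ∧ w + (planarBrownian s ω - (s : ℝ) • planarBrownian 1 ω) ∈ A) ∧
        ∀ s : ℝ≥0, s ≤ 1 → w + (planarBrownian s ω - (s : ℝ) • planarBrownian 1 ω) ∉ O} = Prod.mk ω ⁻¹' M) ∧
      (∀ w : ℂ, {ω : WienerPair | (∃ s : ℝ≥0, s ≤ i ∧ w + (planarBrownian s ω - (s : ℝ) • planarBrownian 1 ω) ∈ A) ∧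
        ∀ s : ℝ≥0, s ≤ 1 → w + (planarBrownian s ω - (s : ℝ) • planarBrownian 1 ω) ∉ O} = (fun ω ↦ (ω, w)) ⁻¹' M) := by
  set Φ : ℝ≥0 → (WienerPair × ℂ) → ℂ := fun s x ↦ x.2 + (planarBrownian s x.1 - (s : ℝ) • planarBrownian 1 x.1)
    with hΦ
  have hΦm : ∀ s, Measurable (Φ s) := fun s ↦ by
    simp only [hΦ]
    exact measurable_snd.add (((BrownianLoop.measurable_planarBrownian s).comp measurable_fst).sub
      (((BrownianLoop.measurable_planarBrownian 1).comp measurable_fst).const_smul (s : ℝ)))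
  have hΦc : ∀ x, Continuous fun s ↦ Φ s x := fun x ↦ by
    simp only [hΦ]
    exact continuous_const.add ((BrownianLoop.continuous_planarBrownian x.1).sub
      (NNReal.continuous_coe.smul continuous_const))
  refine ⟨{x | ∃ s : ℝ≥0, s ≤ i ∧ Φ s x ∈ A} ∩ {x | ∀ s : ℝ≥0, s ≤ 1 → Φ s x ∉ O},
    (measurableSet_exists_le_mem hΦm hΦc hA i).inter (measurableSet_forall_notMem hΦm hΦc hO 1),
    fun ω ↦ ?_, fun w ↦ ?_⟩
  · ext w; simp [hΦ]
  · ext ω; simp [hΦ]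

/-- The expected-area functional of a bridge event is a measurable function of the sample.
[folklore] -/
theorem measurable_volume_bridge_event {A : Set ℂ} (hA : IsClosed A) {O : Set ℂ} (hO : IsOpen O) (i : ℝ≥0) :
    Measurable fun ω : WienerPair ↦ volume {w : ℂ | (∃ s : ℝ≥0, s ≤ i ∧
        w + (planarBrownian s ω - (s : ℝ) • planarBrownian 1 ω) ∈ A) ∧
        ∀ s : ℝ≥0, s ≤ 1 → w + (planarBrownian s ω - (s : ℝ) • planarBrownian 1 ω) ∉ O} := by
  obtain ⟨M, hM, h1, -⟩ := exists_measurableSet_bridge_event hA hO i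
  simp_rw [h1]
  exact measurable_measure_prodMk_left hM

/-- **Tonelli for bridge events**: the expected area of the set of roots `w` for which the bridge
event holds is the integral over `w` of its probability. [folklore] -/
theorem lintegral_volume_bridge_event_eq_lintegral_measure {A : Set ℂ} (hA : IsClosed A) {O : Set ℂ}
    (hO : IsOpen O) (i : ℝ≥0) :
    ∫⁻ ω, volume {w : ℂ | (∃ s : ℝ≥0, s ≤ i ∧ w + (planarBrownian s ω - (s : ℝ) • planarBrownian 1 ω) ∈ A) ∧
        ∀ s : ℝ≥0, s ≤ 1 → w + (planarBrownian s ω - (s : ℝ) • planarBrownian 1 ω) ∉ O} ∂wienerPair =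
    ∫⁻ w, wienerPair {ω | (∃ s : ℝ≥0, s ≤ i ∧ w + (planarBrownian s ω - (s : ℝ) • planarBrownian 1 ω) ∈ A) ∧
        ∀ s : ℝ≥0, s ≤ 1 → w + (planarBrownian s ω - (s : ℝ) • planarBrownian 1 ω) ∉ O} ∂(volume : Measure ℂ) := by
  obtain ⟨M, hM, h1, h2⟩ := exists_measurableSet_bridge_event hA hO i
  simp_rw [h1, h2]
  rw [← Measure.prod_apply hM, Measure.prod_apply_symm hM]

/-- **The Brownian event "hit `B̄(c, a)` by time `i`" is in `𝓕_j` for `i ≤ j`** (natural filtration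
of the planar Brownian motion of the pair; the hitting time of a closed set is a stopping time).
[folklore] -/
theorem measurableSet_natFiltration_hit (w c : ℂ) (a : ℝ) {i j : ℝ≥0} (hij : i ≤ j) :
    MeasurableSet[isBrownianVec_planar.natFiltration j] {ω | ∃ s ≤ i, w + planarBrownian s ω ∈ closedBall c a} := by
  set W : ℝ≥0 → WienerPair → (Fin 2 → ℝ) := fun t ω ↦ ![brownian t ω.1, brownian t ω.2] with hWdef
  have hW : IsBrownianVec W wienerPair := isBrownianVec_planar
  set x₀ : Fin 2 → ℝ := ![w.re, w.im] with hx₀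
  set N : (Fin 2 → ℝ) → ℝ := fun v ↦ ‖(v 0 : ℂ) + (v 1 : ℂ) * I - c‖ with hNdef
  have hNcont : Continuous N := (continuous_toC.sub continuous_const).norm
  have hNX : ∀ s ω, N (x₀ + W s ω) = ‖w + planarBrownian s ω - c‖ := fun s ω ↦ by
    simp only [hNdef, hx₀, hWdef]; rw [toC_start_add_planar]
  set A₁ : Set (Fin 2 → ℝ) := {v | N v ≤ a} with hA₁
  have hA₁c : IsClosed A₁ := isClosed_le hNcont continuous_const
  have hτ : IsStoppingTime hW.natFiltration (IsBrownianVec.hitTime x₀ W A₁) := hW.isStoppingTime_hitTime hA₁c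
  have hset : {ω : WienerPair | ∃ s ≤ i, w + planarBrownian s ω ∈ closedBall c a} =
      {ω | IsBrownianVec.hitTime x₀ W A₁ ω ≤ i} := by
    ext ω
    simp only [mem_setOf_eq]
    rw [hW.hitTime_le_coe_iff hA₁c]
    refine exists_congr fun s ↦ and_congr_right fun _ ↦ ?_
    simp only [hA₁, mem_setOf_eq, hNX, mem_closedBall, dist_eq_norm]
  rw [hset]
  exact hW.natFiltration.mono hij _ (hτ i)

/-- **The Brownian event "avoid `B̄(c, a)` up to time `j`" is in `𝓕_j`.** [folklore] -/
theorem measurableSet_natFiltration_avoid (w c : ℂ) (a : ℝ) (j : ℝ≥0) :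
    MeasurableSet[isBrownianVec_planar.natFiltration j] {ω | ∀ s ≤ j, w + planarBrownian s ω ∉ closedBall c a} := by
  set W : ℝ≥0 → WienerPair → (Fin 2 → ℝ) := fun t ω ↦ ![brownian t ω.1, brownian t ω.2] with hWdef
  have hW : IsBrownianVec W wienerPair := isBrownianVec_planar
  set x₀ : Fin 2 → ℝ := ![w.re, w.im] with hx₀
  set N : (Fin 2 → ℝ) → ℝ := fun v ↦ ‖(v 0 : ℂ) + (v 1 : ℂ) * I - c‖ with hNdef
  have hNcont : Continuous N := (continuous_toC.sub continuous_const).norm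
  have hNX : ∀ s ω, N (x₀ + W s ω) = ‖w + planarBrownian s ω - c‖ := fun s ω ↦ by
    simp only [hNdef, hx₀, hWdef]; rw [toC_start_add_planar]
  set A₁ : Set (Fin 2 → ℝ) := {v | N v ≤ a} with hA₁
  have hA₁c : IsClosed A₁ := isClosed_le hNcont continuous_const
  have hτ : IsStoppingTime hW.natFiltration (IsBrownianVec.hitTime x₀ W A₁) := hW.isStoppingTime_hitTime hA₁c
  have hset : {ω : WienerPair | ∀ s ≤ j, w + planarBrownian s ω ∉ closedBall c a} =
      {ω | IsBrownianVec.hitTime x₀ W A₁ ω ≤ j}ᶜ := by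
    ext ω
    simp only [mem_setOf_eq, mem_compl_iff]
    rw [hW.hitTime_le_coe_iff hA₁c]
    simp only [hA₁, mem_setOf_eq, hNX, mem_closedBall, dist_eq_norm, not_exists, not_and]
  rw [hset]
  exact (hτ j).compl

/-! ### The chain -/

/-- **The chain of estimates for large loops (free parameters).** Let `c ∈ ℂ`, `R' ≥ 0`,
`0 < r' ≤ 8`, and put `η = r'/8`, `a = R' + |c| + r'`, `r₁ = r'/2`. For every `ρ > a` and all
parameters `s₀, λ, Λ` admissible for `lintegral_measure_hit_closedBall_le` (with `t = 1/2`,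
radius `a`),

  `E |{w : (∃ s ≤ 1, w + b_s ∈ B̄(0, R')) ∧ ∀ s ≤ 1, w + b_s ∉ B(c, r')}|`
    `≤ 2 · (7/η²) · (2η/√(2π/4))² · (log(a/r₁)/log(ρ/r₁) + ρ²/(2/4)) ·`
      `( |B̄(·, s₀)| + |B̄(·, Λ)| ((λ/s₀)/log(λ/a) + 2¹² (1/2)²/λ⁴) + (2¹⁹ (1/2)²/Λ) ∫ (1 + |w|)⁻³ dA )`.

[cite: Lawler2009, §2.2 (finiteness of Λ(K₁,K₂;D), stated)] -/
theorem lintegral_volume_bridge_hit_avoid_le {c : ℂ} {R' r' ρ s₀ lam Λ : ℝ} (hR' : 0 ≤ R')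
    (hr' : 0 < r') (hr'8 : r' ≤ 8) (hρ : R' + ‖c‖ + r' < ρ)
    (has : R' + ‖c‖ + r' ≤ s₀) (hal : R' + ‖c‖ + r' < lam) (hl8 : 8 ≤ lam)
    (hΛ8 : R' + ‖c‖ + r' + 8 ≤ Λ) (hΛa : 2 * (R' + ‖c‖ + r') ≤ Λ) (hΛ1 : 1 ≤ Λ) :
    ∫⁻ ω, volume {w : ℂ | (∃ s : ℝ≥0, s ≤ 1 ∧
        w + (planarBrownian s ω - (s : ℝ) • planarBrownian 1 ω) ∈ closedBall 0 R') ∧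
        ∀ s : ℝ≥0, s ≤ 1 → w + (planarBrownian s ω - (s : ℝ) • planarBrownian 1 ω) ∉ ball c r'} ∂wienerPair ≤
      2 * (ENNReal.ofReal (7 / (r' / 8) ^ 2) *
        ENNReal.ofReal ((2 * (r' / 8) * (Real.sqrt (2 * Real.pi * ((1 - 3 / 4 : ℝ≥0) : ℝ)))⁻¹) ^ 2) *
        ENNReal.ofReal (Real.log ((R' + ‖c‖ + r') / (r' / 2)) / Real.log (ρ / (r' / 2)) +
            ρ ^ 2 / (2 * (4⁻¹ : ℝ≥0))) *
          (ENNReal.ofReal s₀ ^ 2 * NNReal.pi +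
            ENNReal.ofReal Λ ^ 2 * NNReal.pi *
              (ENNReal.ofReal (lam / s₀ / Real.log (lam / (R' + ‖c‖ + r'))) +
                ENNReal.ofReal (2 ^ 12 * ((2⁻¹ : ℝ≥0) : ℝ) ^ 2 / lam ^ 4)) +
            ENNReal.ofReal (2 ^ 19 * ((2⁻¹ : ℝ≥0) : ℝ) ^ 2 / Λ) *
              ∫⁻ w, ENNReal.ofReal ((1 + ‖w‖) ^ (-(3 : ℝ))) ∂(volume : Measure ℂ))) := by
  -- names
  set η : ℝ := r' / 8 with hηdef
  have hη0 : 0 < η := by positivity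
  have hη1 : η ≤ 1 := by rw [hηdef]; linarith
  set a : ℝ := R' + ‖c‖ + r' with hadef
  set r₁ : ℝ := r' / 2 with hr₁def
  have hr₁ : 0 < r₁ := by positivity
  have hra : r₁ < a := by rw [hr₁def, hadef]; linarith [norm_nonneg c]
  have ha : 0 < a := hr₁.trans hra
  have hA : IsClosed (closedBall (0 : ℂ) R') := isClosed_closedBall
  have hO : IsOpen (ball c r') := isOpen_ball
  set bp : ℝ≥0 → WienerPair → ℂ := fun s ω ↦ planarBrownian s ω - (s : ℝ) • planarBrownian 1 ω with hbp
  ----------------------------------------------------------------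
  -- Step 1: split the hitting time at `1/2`, reverse time in the late part
  ----------------------------------------------------------------
  set Gearly : WienerPair → ℝ≥0∞ := fun ω ↦ volume {w : ℂ | (∃ s : ℝ≥0, s ≤ 2⁻¹ ∧ w + bp s ω ∈ closedBall 0 R') ∧
    ∀ s : ℝ≥0, s ≤ 1 → w + bp s ω ∉ ball c r'} with hGearly
  set Glate : WienerPair → ℝ≥0∞ := fun ω ↦ volume {w : ℂ | (∃ s : ℝ≥0, 2⁻¹ ≤ s ∧ s ≤ 1 ∧ w + bp s ω ∈ closedBall 0 R') ∧
    ∀ s : ℝ≥0, s ≤ 1 → w + bp s ω ∉ ball c r'} with hGlate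
  have hGearly_m : Measurable Gearly := measurable_volume_bridge_event hA hO 2⁻¹
  have hrev : ∫⁻ ω, Glate ω ∂wienerPair = ∫⁻ ω, Gearly ω ∂wienerPair :=
    lintegral_volume_bridge_hit_late_eq_early hA hO
  have hsplit : ∀ ω : WienerPair, volume {w : ℂ | (∃ s : ℝ≥0, s ≤ 1 ∧ w + bp s ω ∈ closedBall 0 R') ∧
      ∀ s : ℝ≥0, s ≤ 1 → w + bp s ω ∉ ball c r'} ≤ Glate ω + Gearly ω := by
    intro ω
    refine (measure_mono ?_).trans (measure_union_le _ _)
    rintro w ⟨⟨s, hs1, hs⟩, havoid⟩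
    by_cases h : 2⁻¹ ≤ s
    · exact Or.inl ⟨⟨s, h, hs1, hs⟩, havoid⟩
    · exact Or.inr ⟨⟨s, (not_le.1 h).le, hs⟩, havoid⟩
  have hstep1 : ∫⁻ ω, volume {w : ℂ | (∃ s : ℝ≥0, s ≤ 1 ∧ w + bp s ω ∈ closedBall 0 R') ∧
      ∀ s : ℝ≥0, s ≤ 1 → w + bp s ω ∉ ball c r'} ∂wienerPair ≤ 2 * ∫⁻ ω, Gearly ω ∂wienerPair := by
    calc ∫⁻ ω, volume {w : ℂ | (∃ s : ℝ≥0, s ≤ 1 ∧ w + bp s ω ∈ closedBall 0 R') ∧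
          ∀ s : ℝ≥0, s ≤ 1 → w + bp s ω ∉ ball c r'} ∂wienerPair
        ≤ ∫⁻ ω, (Glate ω + Gearly ω) ∂wienerPair := lintegral_mono hsplit
      _ = ∫⁻ ω, Glate ω ∂wienerPair + ∫⁻ ω, Gearly ω ∂wienerPair := lintegral_add_right _ hGearly_m
      _ = 2 * ∫⁻ ω, Gearly ω ∂wienerPair := by rw [hrev, two_mul]
  ----------------------------------------------------------------
  -- Step 2: Tonelli
  ----------------------------------------------------------------
  have hstep2 : ∫⁻ ω, Gearly ω ∂wienerPair =
      ∫⁻ w, wienerPair {ω | (∃ s : ℝ≥0, s ≤ 2⁻¹ ∧ w + bp s ω ∈ closedBall 0 R') ∧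
        ∀ s : ℝ≥0, s ≤ 1 → w + bp s ω ∉ ball c r'} ∂(volume : Measure ℂ) :=
    lintegral_volume_bridge_event_eq_lintegral_measure hA hO 2⁻¹
  ----------------------------------------------------------------
  -- Steps 3–6: the pointwise chain in `w`
  ----------------------------------------------------------------
  have h12 : (2⁻¹ : ℝ≥0) ≤ 1 := by norm_num
  have h34 : (3 / 4 : ℝ≥0) < 1 := by
    rw [← NNReal.coe_lt_coe]; push_cast; norm_num
  have hsum : (2⁻¹ : ℝ≥0) + 4⁻¹ ≤ 3 / 4 := by
    rw [← NNReal.coe_le_coe]; push_cast; norm_num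
  have haρ : a < ρ := hρ
  set K₁ : ℝ≥0∞ := ENNReal.ofReal (7 / η ^ 2) with hK₁
  set K₂ : ℝ≥0∞ := ENNReal.ofReal ((2 * η * (Real.sqrt (2 * Real.pi * ((1 - 3 / 4 : ℝ≥0) : ℝ)))⁻¹) ^ 2) with hK₂
  set K₃ : ℝ≥0∞ := ENNReal.ofReal (Real.log (a / r₁) / Real.log (ρ / r₁) + ρ ^ 2 / (2 * (4⁻¹ : ℝ≥0))) with hK₃
  have hpt : ∀ w : ℂ, wienerPair {ω | (∃ s : ℝ≥0, s ≤ 2⁻¹ ∧ w + bp s ω ∈ closedBall 0 R') ∧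
      ∀ s : ℝ≥0, s ≤ 1 → w + bp s ω ∉ ball c r'} ≤
      K₁ * K₂ * K₃ * wienerPair {ω | ∃ s ≤ (2⁻¹ : ℝ≥0), w + planarBrownian s ω ∈ closedBall c a} := by
    intro w
    -- Step 3: transfer to a small endpoint
    have h3 := measure_bridge_event_le_mul_inter_small w hA hO h12 hη0 hη1
    -- Step 4: on the small-endpoint event, the Brownian path realizes the Brownian event
    set BMev : Set WienerPair := {ω | (∃ s ≤ (2⁻¹ : ℝ≥0), w + planarBrownian s ω ∈ closedBall c a) ∧
      ∀ s ≤ (3 / 4 : ℝ≥0), w + planarBrownian s ω ∉ closedBall c r₁} with hBMev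
    set small : Set WienerPair := {ω | |brownian 1 ω.1| ≤ η ∧ |brownian 1 ω.2| ≤ η} with hsmall
    have h4 : {ω : WienerPair | (∃ s ≤ (2⁻¹ : ℝ≥0), w + (planarBrownian s ω - (s : ℝ) • planarBrownian 1 ω) ∈ closedBall 0 R') ∧
        ∀ s ≤ (1 : ℝ≥0), w + (planarBrownian s ω - (s : ℝ) • planarBrownian 1 ω) ∉ ball c r'} ∩ small ⊆
        BMev ∩ small := by
      rintro ω ⟨⟨⟨s, hs, hsA⟩, havoid⟩, hω⟩
      refine ⟨⟨⟨s, hs, ?_⟩, fun s' hs' hmem ↦ ?_⟩, hω⟩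
      · -- the hit, fattened by `2η`, lies in `B̄(c, a)`
        have hclose := norm_sub_bridge_le hω (hs.trans h12) w
        rw [mem_closedBall, dist_zero_right] at hsA
        rw [mem_closedBall, dist_eq_norm]
        have : ‖w + planarBrownian s ω - c‖ ≤
            ‖(w + planarBrownian s ω) - (w + (planarBrownian s ω - (s : ℝ) • planarBrownian 1 ω))‖ +
              ‖w + (planarBrownian s ω - (s : ℝ) • planarBrownian 1 ω)‖ + ‖c‖ := by
          calc ‖w + planarBrownian s ω - c‖
              ≤ ‖w + planarBrownian s ω‖ + ‖c‖ := norm_sub_le _ _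
            _ ≤ (‖(w + planarBrownian s ω) - (w + (planarBrownian s ω - (s : ℝ) • planarBrownian 1 ω))‖ +
                  ‖w + (planarBrownian s ω - (s : ℝ) • planarBrownian 1 ω)‖) + ‖c‖ := by
                gcongr; exact norm_le_norm_sub_add _ _
        rw [hadef, hηdef] at *
        linarith
      · -- a visit of `B̄(c, r₁)` by the Brownian path forces the bridge into `B(c, r')`
        have hs'1 : s' ≤ 1 := hs'.trans h34.le
        have hclose := norm_sub_bridge_le hω hs'1 w
        rw [mem_closedBall, dist_eq_norm] at hmem
        refine havoid s' hs'1 ?_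
        rw [mem_ball, dist_eq_norm]
        calc ‖w + (planarBrownian s' ω - (s' : ℝ) • planarBrownian 1 ω) - c‖
            ≤ ‖(w + (planarBrownian s' ω - (s' : ℝ) • planarBrownian 1 ω)) - (w + planarBrownian s' ω)‖ +
                ‖w + planarBrownian s' ω - c‖ := norm_sub_le_norm_sub_add_norm_sub _ _ _
          _ ≤ 2 * η + r₁ := by rw [norm_sub_rev]; exact add_le_add hclose hmem
          _ < r' := by rw [hηdef, hr₁def]; linarith
    -- Step 5: the small endpoint given the Brownian event (an event of `𝓕_{3/4}`)
    have hmeas : MeasurableSet[isBrownianVec_planar.natFiltration (3 / 4)] BMev :=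
      (measurableSet_natFiltration_hit w c a (show (2⁻¹ : ℝ≥0) ≤ 3 / 4 from le_trans le_self_add hsum)).inter
        (measurableSet_natFiltration_avoid w c r₁ (3 / 4))
    have h5 := measure_inter_endpoints_small_le h34 hmeas hη0.le
    -- Step 6: avoidance after the hit
    have h6 := measure_hit_then_avoid_le (c := c) w hr₁ hra haρ (θ := 4⁻¹) (t₁ := 2⁻¹) (T := 3 / 4)
      (by norm_num) hsum
    -- chain
    calc wienerPair {ω | (∃ s : ℝ≥0, s ≤ 2⁻¹ ∧ w + bp s ω ∈ closedBall 0 R') ∧ ∀ s : ℝ≥0, s ≤ 1 → w + bp s ω ∉ ball c r'}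
        ≤ K₁ * wienerPair ({ω | (∃ s ≤ (2⁻¹ : ℝ≥0), w + (planarBrownian s ω - (s : ℝ) • planarBrownian 1 ω) ∈ closedBall 0 R') ∧
            ∀ s ≤ (1 : ℝ≥0), w + (planarBrownian s ω - (s : ℝ) • planarBrownian 1 ω) ∉ ball c r'} ∩ small) := h3
      _ ≤ K₁ * wienerPair (BMev ∩ small) := by gcongr
      _ ≤ K₁ * (K₂ * wienerPair BMev) := by gcongr
      _ ≤ K₁ * (K₂ * (K₃ * wienerPair {ω | ∃ s ≤ (2⁻¹ : ℝ≥0), w + planarBrownian s ω ∈ closedBall c a})) := by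
          gcongr
      _ = K₁ * K₂ * K₃ * wienerPair {ω | ∃ s ≤ (2⁻¹ : ℝ≥0), w + planarBrownian s ω ∈ closedBall c a} := by ring
  ----------------------------------------------------------------
  -- Step 7: the expected sausage area, and assembly
  ----------------------------------------------------------------
  have h7 := lintegral_measure_hit_closedBall_le (c := c) (t := 2⁻¹) (by norm_num) ha has hal hl8 hΛ8 hΛa hΛ1
  have hKtop : K₁ * K₂ * K₃ ≠ ∞ :=
    ENNReal.mul_ne_top (ENNReal.mul_ne_top ENNReal.ofReal_ne_top ENNReal.ofReal_ne_top) ENNReal.ofReal_ne_top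
  calc ∫⁻ ω, volume {w : ℂ | (∃ s : ℝ≥0, s ≤ 1 ∧ w + bp s ω ∈ closedBall 0 R') ∧
        ∀ s : ℝ≥0, s ≤ 1 → w + bp s ω ∉ ball c r'} ∂wienerPair
      ≤ 2 * ∫⁻ ω, Gearly ω ∂wienerPair := hstep1
    _ = 2 * ∫⁻ w, wienerPair {ω | (∃ s : ℝ≥0, s ≤ 2⁻¹ ∧ w + bp s ω ∈ closedBall 0 R') ∧
          ∀ s : ℝ≥0, s ≤ 1 → w + bp s ω ∉ ball c r'} ∂(volume : Measure ℂ) := by rw [hstep2]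
    _ ≤ 2 * ∫⁻ w, K₁ * K₂ * K₃ * wienerPair {ω | ∃ s ≤ (2⁻¹ : ℝ≥0), w + planarBrownian s ω ∈ closedBall c a}
          ∂(volume : Measure ℂ) := by gcongr; exact hpt _
    _ = 2 * (K₁ * K₂ * K₃ * ∫⁻ w, wienerPair {ω | ∃ s ≤ (2⁻¹ : ℝ≥0), w + planarBrownian s ω ∈ closedBall c a}
          ∂(volume : Measure ℂ)) := by rw [lintegral_const_mul' _ _ hKtop]
    _ ≤ _ := by gcongr

end Literature.Probability.RandomPlanarGeometry

end
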